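import Mathlib
import HarnessLib
import HarnessLib.Audit
import Summits.QuantumFields.Statement
import Summits.QuantumFields.YangMills.Theses.VirialFluxGap
import Summits.QuantumFields.YangMills.Theorems.VirialFluxGapRingDeficitDefs
import Summits.QuantumFields.YangMills.Theorems.VirialFluxGapDeficitForm
import Summits.QuantumFields.YangMills.Theorems.VirialFluxGapPeriodicSoftnessWindowArithmeticZero
import HarnessLib.Audit.Status.Attr

/-!
Route: ToronValleyVolume

# Route ToronValleyVolume — The toron valley as a singular Morse–Bott stratum — periodic softness
from a power-log tube volume law, a polynomial Łojasiewicz localisation and a Tauberian mean bound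

D-0145 LINE g15-B of ideator seat ym-idea-4 (technique card «spectral / trace methods»); a
SUB-ROUTE, DRAFT by design. TARGET LEAF BY NAME: `VirialFluxGap.PeriodicSoftness` (item
stmt-QuantumFields-24141, the DECIDING crux r2 of route-QuantumFields-VirialFluxGap = my LINE g14-A;
bears_on 24141 → `VirialFluxGap.closes` → ⟨24079⟩ → the RECORD tower R2ξ″ ⟨22804⟩ of LADDER-YM §1c).
It suffices to show X = ToronTubeVolumeLaw ∧ LojasiewiczLocalise ∧ TauberMeanUpper: the periodic
(zero-flux) action deficit F₀ on ring histories has (i) a POWER-LOG sublevel-volume law μ({F₀ ≤ t} ∩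
Tube) = v·t^(9L⁴−3/2)·(e·log t⁻¹ + c)·(1 ± K₁L^(q₁)t^θ) in a polynomial tube around the toron valley
{F₀ = 0}, (ii) a polynomial Łojasiewicz localisation F₀ ≤ (KL^q)⁻¹ ⇒ dist(·, valley) ≤ KL^q·F₀^α,
and (iii) the elementary uniform Tauberian bound «power-log small-ball law ⇒ β⟨F₀⟩_β ≤ ρ +
O(κβ^(−θ)) + 2/β»; with the LANDED virial identity `RingDeficit.deficitFormZero` and window
arithmetic `stub_windowArithmeticZero` these give PeriodicSoftness with softness constant c = 1
(indeed any c < 3/2). No summit statement is proved by this line: ⟨24141⟩, ⟨24079⟩ and YangMills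
stay OPEN; the route is born draft (sub-route: `closes` concludes the leaf, not `YangMills`).
Lean: `ToronTubeVolumeLaw → LojasiewiczLocalise → TauberMeanUpper →
Summit.QuantumFields.YangMills.Theses.VirialFluxGap.PeriodicSoftness`

## Assembly
From ToronTubeVolumeLaw get (p, K₁, q₁, θ, v, e, c, L₁), from LojasiewiczLocalise (α, K, q, L₂);
route constants K' = K₁ + K + K^(1/α), q' = q₁ + q + (q+p)/α, κ' = K'L^(q'), L₀ = max(L₁, L₂, 1),
and the window (a, β₀) = `stub_windowArithmeticZero K' q' θ` (landed: a = θ/(4(q'+10))). For β ≥ β₀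
and L₀ ≤ L ≤ β^a: for t ≤ κ'⁻¹ the localisation gives dist ≤ KL^q·t^α ≤ L^(−p), so {F₀ ≤ t} = {F₀ ≤
t} ∩ Tube and the tube law is the GLOBAL law with constant κ' on (0, κ'⁻¹]; TauberMeanUpper with ρ =
9L⁴ − 3/2, t₀ = ℓ₀ = κ'⁻¹ and the window's thresholds gives β⟨F₀⟩ ≤ 9L⁴ − 3/2 + 1/2; the landed
deficitFormZero (β·d/dβ log W₀ = 12βL⁴ − β⟨F₀⟩) turns this into 12βL⁴ − 9L⁴ + 1 ≤ β·deriv log W₀,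
i.e. PeriodicSoftness with c := 1. Kernel-checked in lineB/Sketch.lean (`theorem closes`, rc 0, no
sorry).

Rationale: WHY THIS LINE. Mechanism (the lever): THE TORON VALLEY AS A SINGULAR MORSE–BOTT STRATUM WITH A REAL
LOG-CANONICAL THRESHOLD. In the periodic sector the zero set of the deficit is not rigid: it is the
valley of flat ring histories = gauge orbits of COMMUTING holonomy quadruples (three spatial
Polyakov holonomies + the seam holonomy) — the lattice torons / vacuum valley of
GonzalezarroyoAltes1988, KollerVanbaal1986, Vanbaal2001 ([corpus:paper:arxiv-hep-th_9807108 p.12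
§8.1] for the zero-action classification; CosteEtAl1985 for the one-loop valley effective
potential). Its codimension is 18L⁴ − 3 (generic stabiliser U(1) instead of the centre: three extra
flat directions relative to the twisted sectors), so the Gibbs mean of βF₀ is 9L⁴ − 3/2 + o(1) —
exactly 3/2 BELOW the twisted count 9L⁴, which is what PeriodicSoftness (c > 0 suffices; we get c =
1) asks. The new object relative to every listed route is the VOLUME LAW of the valley INCLUDING ITS
SINGULAR CENTRAL STRATA: where holonomies hit ±1 the stabiliser jumps to SU(2), the transverse
deficit is the homogeneous quartic Σ‖[c_μ,c_ν]‖² of four su(2) zero modes, and the real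
log-canonical threshold (Watanabe, doi:10.1017/cbo9780511800474 Thm 6.7/Rem 1.15; AGZV asymptotics
of oscillatory integrals) has multiplicity 2 — ONE LOG in the small-ball law (our deterministic
quadrature kit j327769: Z₄(β)β³ linear in log β, increment 0.0360/decade; the σ-block k = 3 has no
log). Imported from singular learning theory / asymptotic analysis: state-density functions with
power-log leading term and their Laplace–Tauberian calculus
(book:ganeliusnd-tauberian-remainder-theorems ch. 2–3; arXiv:2305.17604 for the dimension-explicit
Laplace regime d² ≪ n that fixes the window L ≤ β^a). Why easier than the leaf: the leaf is a
statement about a derivative of a log-partition function uniformly on windows; the line replaces it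
by (i) a β-FREE geometric statement about ONE algebraic variety (the commuting variety of SU(2)⁴
fibred over the gauge orbit) whose local models are explicit, (ii) a deterministic inequality, (iii)
bookkeeping already landed (deficitFormZero, stub_windowArithmeticZero) plus real analysis
(TauberMeanUpper). The twisted sibling ⟨24204⟩ got the RIGID version of this architecture in LINE
g15-A (TwistEaterVolume: pure power law, linear Łojasiewicz); here the valley is singular, the
exponent drops by 3/2, a log appears, the Łojasiewicz rate becomes Hölder, and the Tauberian side is
ONE-sided for MEANS (the leaf is an inequality), so none of g15-A's three items is reused.

RANKED CRUXES. #2 ToronTubeVolumeLaw (crux) — TORON-VALLEY TUBE VOLUME LAW: there are p ≥ 0, K₁ > 0,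
q₁ ≥ 0, θ ∈ (0,1], sequences v(L) > 0, e(L) ≥ 0, c(L) with |log v(L)| ≤ K₁L^(q₁), and L₀, such that
for L ≥ L₀ and 0 < t ≤ (K₁L^(q₁))⁻¹ the slowly varying factor e(L)·log t⁻¹ + c(L) is ≥ (K₁L^(q₁))⁻¹
and the ring-measure volume of {F₀ ≤ t} ∩ {dist(·, {F₀ = 0}) ≤ L^(−p)} equals v·t^(9L⁴ − 3/2)·(e·log
t⁻¹ + c)·(1 ± K₁L^(q₁)·t^θ) (dist = the inlined squared chordal ring distance; F₀ =
`RingDeficit.ringDeficit L 0`). [difficulty: L] (why it might fail: the central strata (holonomies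
at ±1, stabiliser SU(2)) might carry RLCT multiplicity 3 (a log² term) or a pole below 9L⁴−3/2 once
the non-zero modes couple to the quartic cone, and t^θ-uniformity with poly(L) constants over all
strata is unproved beyond the k=4 zero-mode toy.) [doi:10.1017/cbo9780511800474, CosteEtAl1985,
KollerVanbaal1986, Vanbaal2001, GonzalezarroyoAltes1988, doi:10.48550/arxiv.hep-th/9807108,
arXiv:2305.17604]
#3 LojasiewiczLocalise (crux) — POLYNOMIAL ŁOJASIEWICZ LOCALISATION for the periodic deficit: there
are α ∈ (0,1], K > 0, q ≥ 0, L₀ such that for L ≥ L₀ and every ring history P with F₀(P) ≤ (K·L^q)⁻¹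
one has dist(P, {F₀ = 0}) ≤ K·L^q·F₀(P)^α (same inlined squared chordal distance; expected α = 1/2
from the quartic commutator cone, α = 1 at regular points of the valley; the assembly needs only α >
0). It supplies the localisation into the tube of ToronTubeVolumeLaw and excludes near-flat non-flat
strata far from the valley. [difficulty: L] (why it might fail: needs gauge fixing over 2L·L³ sites
with only poly(L) loss AND a quantitative almost-commuting ⇒ near-commuting bound for SU(2)⁴ with a
FIXED Hölder exponent; near the cone point with non-zero modes coupled the prefactor could be
e^(cL), not poly(L).) [doi:10.48550/arxiv.hep-th/9807108, GonzalezarroyoAltes1988, Vanbaal2001,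
KollerVanbaal1986, Luscher1983]
#9 TauberMeanUpper (support) — UNIFORM TAUBERIAN MEAN BOUND with one slowly varying log factor
(elementary, dimension-explicit): on a probability space, a measurable F ≥ 0 with |μ(F ≤
t)/(v·t^ρ·(e·log t⁻¹ + c)) − 1| ≤ κ·t^θ and e·log t⁻¹ + c ≥ ℓ₀ > 0 on (0, t₀] (ρ ≥ 1, v > 0, e ≥ 0,
κ ≥ 0, θ ∈ (0,1]) satisfies, for every β ≥ 2 with κ((ρ+2)/β)^θ ≤ 1/4 and 64(ρ+2)²(1 + |log v| + |log
ℓ₀| + |log t₀| + log β) ≤ β·t₀: β·∫F e^(−βF)dμ / ∫e^(−βF)dμ ≤ ρ + (4ρ+5)·κ·((ρ+2)/β)^θ + 2/β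
(verbatim the Prop of the «tauber-mean» evidence skeleton on ⟨24141⟩; signed-kernel layer cake, IBP
on (0,t₀], Chebyshev association for the decreasing slowly varying factor, Gautschi, exponential
tails under the threshold). [difficulty: M] [book:ganeliusnd-tauberian-remainder-theorems,
arXiv:2305.17604, doi:10.1017/cbo9780511800474]

TWO-LAYER PLAN. ToronTubeVolumeLaw ⇐ ToronStateDensityLaw (the HEART in Watanabe form: the
F₀-pushforward of the tube-restricted ring measure has a STATE DENSITY f(s) = v·s^(λ−1)·(λ(e·log s⁻¹
+ c) − e)·(1 ± κs^θ), λ = 9L⁴ − 3/2 — resolution of the commutator-quartic singularity fibred over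
the valley; largest pole of the local zeta function ∫F₀^z φ at −λ with multiplicity 2) →
IntegrateStateDensity (pure real analysis: the state-density law integrates to the cumulative law
with the same v, e, c since d/dt[t^λ(e·log t⁻¹ + c)] = t^(λ−1)(λ(e·log t⁻¹ + c) − e); relative error
4κ) → ToronTubeVolumeLaw, composition kernel-checked in lineB/bc/ToronTubeVolumeLaw_birth.lean (+
BC5 plan-only rung stub_rung_zeroModeLog4). LojasiewiczLocalise ⇐ LocalLojasiewicz (the Hölder
inequality INSIDE a polynomial tube: local models = regular valley points (quadratic) and the
central cone (quartic)) → LocaliseZero (∀ p: polynomially small F₀ ⇒ inside the L^(−p) tube: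
path-ordered gauge fixing + almost-commuting-implies-near-commuting for SU(2)⁴ with polynomial loss)
→ LojasiewiczLocalise, kernel-checked in lineB/bc/LojasiewiczLocalise_birth.lean. TauberMeanUpper is
one M-sized real-analysis file (layer cake + IBP + Chebyshev association + Gamma/Gautschi + tails) —
fcl-p3's VirialFluxGapLaplaceLayerCake / ChebyshevGamma files (landed 08:40Z/08:47Z toward
stub_tauberMeanUpper) are directly reusable.

KILL CRITERIA. ToronTubeVolumeLaw is refuted (route closed refuted:ToronTubeVolumeLaw) by a Theorems
file exhibiting, for a sequence of L, tube-restricted sublevel volumes of F₀ whose ratio to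
t^(9L⁴−3/2) is not of the form (e·log t⁻¹ + c)(1 + O(poly(L)·t^θ)) — e.g. a log² (RLCT multiplicity
3 at the central strata), a different exponent (extra flat directions beyond the 3 of the
U(1)-stabiliser count, or fewer), or constants v with |log v| super-polynomial in L.
LojasiewiczLocalise is refuted by a family of ring histories with F₀ ≤ L^(−m) for every m but
squared chordal distance to the valley ≥ L^(−p₀)·F₀^α for every fixed α > 0, K, q (an «approximately
commuting but far from commuting» holonomy configuration with only e^(cL)-loss gauge fixing). Either
refutation retires the line; TauberMeanUpper is model-free real analysis (its refutation would only
re-type the side conditions).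

NOT DECOMPOSED YET. The explicit resolution of singularities of the commutator quartic Σ_(μ<ν)‖c_μ ×
c_ν‖² on (ℝ³)⁴ fibred over the valley and coupled to the 18L⁴ − 12 Gaussian non-zero modes (the
content of ToronStateDensityLaw), the almost-commuting ⇒ near-commuting constant for SU(2)
quadruples, the exponent α, the tube exponent p, and K₁, q₁, θ, K, q — all layer-2 content of the
four registered stubs; no Lie-group calculus on `Matrix.specialUnitaryGroup` is typed at route level
(the items speak only through the landed ringMeasure / ringDeficit / su2Rep / timeCoupling).

CHEAPEST FALSIFIER. The zero-mode toy behind the log (BC5 rung, kit j327769 DONE, deterministic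
quadrature): Z₄(β) = ∫exp(−βΣ_(μ<ν)‖c_μ×c_ν‖² − Σ‖c_μ‖²/2)dc must be ∼ A·β^(−3)·log β (ONE log, A >
0) — measured Z₄β³ = 0.0479 … 0.4039 for β = 10² … 10¹², linear in log β with increment
0.0360/decade, Z₄β³/log β → 0.0146 ✓; a constant Z₄β³ (no log, e = 0 with exponent 3) or a log²
growth would re-type ToronTubeVolumeLaw before any prover time is spent. Instrument row that would
refute the key lemma: the preregistered TWIST-GAP rows (HOME bc/g13-A, job j324611): periodic
β_W⟨S_W⟩ = 142.569 ± 0.023 at 4×2³, β_W = 64 and 142.462 at β_W = 128 versus ρ = 9N/2 − 3/2 = 142.5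
(N = 32 sites) — a periodic mean within 1/2 of 9N/2 = 144 at β_W ≥ 128 (no 3/2 deficit) refutes
ToronTubeVolumeLaw's exponent; a drift of β_W(⟨S⟩_tw − ⟨S⟩_per) (measured 1.89, 1.77, 1.72, 1.73)
below 1 at larger β_W would signal e = 0 and a smaller deficit.

NUMBERS. ρ = 9L⁴ − 3/2 = ½·codim(valley) = ½(18L⁴ − 3): valley = gauge orbit (dim 3·(2L·L³… net 3
per site-slice after gauge) + 3 moduli directions beyond the twisted case (stabiliser U(1) vs
centre), measured 142.569(23) vs 142.5 at L = 2 (N = 32), 70.51 vs 70.5 at 2⁴, 363.93 vs 363.0 at 3⁴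
(β_W = 64; finite-β shifts O(L⁴/β)); log multiplicity 2 from the k = 4 zero-mode block (j327769:
slope 0.0360/decade, A = 0.0156); window a = θ/(4(q'+10)) from the landed WindowArithmeticZero;
softness constant delivered c = 1 (any c < 3/2 − (Tauberian slack) works); Katsevich regime (18L⁴)²
≪ β·t₀ ⇒ a < 1/8 before constants (arXiv:2305.17604).

DEFINITION REQUESTS. None: ring measure, deficit, exponent and the virial identity are the landed
`Theorems/VirialFluxGapRingDeficitDefs.lean` / `VirialFluxGapDeficitForm.lean`; the squared chordal
ring distance and the tube are inlined (the skeletons in lineB/bc/ carry them as local defs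
`ringDist`, `distToValley`, `tubeVol`; a prover may land them as a Defs file first).

Novelty: Searches (2026-08-29, corpus fts+vec AND galaxy; raw outputs lineB/../lit/b_*.txt): lit search
--hybrid "toron vacuum valley SU(2) torus commuting holonomies effective potential" -n 8 →
[corpus:book:greensite2011-introduction-confinement-problem pp.38,157] (torons / twisted b.c. in the
confinement context, no measure statement), string/SUSY books otherwise; held keys CosteEtAl1985,
KollerVanbaal1986, Vanbaal2001 (valley effective Hamiltonians); lit search "almost commuting
matrices near commuting quantitative" -n 8 → [corpus:paper:arxiv-0809.0602 p.3] (almost commuting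
unitaries with spectral gap are near commuting), [corpus:paper:doi-10-1090-s0002-9939-1988-0928973-3
p.5] (Choi 1988: almost commuting need NOT be nearly commuting — dimension-dependent; harmless for
fixed 2×2 blocks, it is the L-uniform gauge-fixing loss that is open),
[corpus:paper:arxiv-1410.2626]; lit vsearch "Lojasiewicz inequality distance to the commuting
variety bounded by a power of the commutator" -k 8 → no relevant hit (algebraic-independence /
transcendence books); lit galaxy search "toron|vacuum valley|commuting holonomies" --star all and
"log canonical threshold|RLCT" --star all → substring noise only (no gauge-theory document); lit
galaxy search --star pdf "real log canonical threshold|singular learning theory" →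
[galaxy:pdf:-3112402077345101080] (arXiv:1002.4589, poles of Archimedean zeta functions for analytic
maps — the general pole/multiplicity theory behind the log) and [galaxy:pdf:141525464  [refs: 1002.4589, 2305.17604, book:greensite2011-introduction-confinement-problem, paper:arxiv-0809.0602, paper:doi-10-1090-s0002-9939-1988-0928973-3, paper:arxiv-1410.2626, paper:arxiv-hep-th_9807108, book:watanabe2009-algebraic-geometry-statistical-learning-theory, book:watanabe2009, CosteEtAl1985, KollerVanbaal1986, Vanbaal2001]

Barriers (technique_class: Morse-Bott volume, Tauberian remainder, toron valley, RLCT): - technique_class: Morse-Bott volume, Tauberian remainder, toron valley, RLCT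
- Literature.Barriers.QuantumFields.PerturbativeInvisibility: outside — no statement about the
continuum mass gap or asymptotic scaling is made; a finite-lattice one-sided mean-action bound on
windows L ≤ β^a feeding the RECORD tower (the barrier quantifies over perturbative series of the
gap, not over sector-weight asymptotics at finite L).
- Literature.Barriers.QuantumFields.DiluteInstantonGasDivergence: outside — no semiclassical gas
over ℝ⁴ or infinite volume is summed and no instanton-size integral appears; the flat (toron) moduli
are integrated EXACTLY in finite volume as part of the valley's volume law, whose L-uniformity is
precisely crux ToronTubeVolumeLaw (the barrier's divergence is the IR size integral, absent at L ≤
β^a with the Gaussian confinement of non-zero modes).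
- Literature.Barriers.QuantumFields.FixedCouplingUltralocality: outside — no scaling limit at fixed
correlation length; β → ∞ with L ≤ β^a.
- Literature.Barriers.QuantumFields.ToronPlaneAnticorrelation: outside — no Griffiths/product-closed
local monotonicity criterion and no plane–plane correlation sign is used; the toron sector enters
only through the sublevel geometry of its own deficit.
- Literature.Barriers.QuantumFields.BanksCasherCriterion: does not apply — pure SU(2) gauge theory,
no fermions, no Dirac spectrum.
- Literature.Barriers.QuantumFields.VafaWittenEigenvalueBound: does not apply — no Dirac operator
anywh

sub-problem: YangMills · status: draft · opened planner-ym-idea-4-g15-0 2026-08-29T10:04:08Z · rev 0 · ledger route-QuantumFields-ToronValleyVolume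
GENERATED by the gate from the ledger (D-0016/17). Provers cite these decls: `theorem foo : Summit.QuantumFields.YangMills.Theses.ToronValleyVolume.<Decl> := …` in Summits/QuantumFields/YangMills/Theorems/<Name>.lean.
-/

namespace Summit.QuantumFields.YangMills.Theses.ToronValleyVolume

open scoped BigOperators Topology Manifold Classical MeasureTheory ProbabilityTheory Matrix InnerProductSpace ComplexConjugate ContinuousMap
open Filter Set Function TopologicalSpace MeasureTheory

attribute [summit_statement] _root_.YangMills

/-- item stmt-QuantumFields-24497 · crux · rank 2 · open · by planner
why it might fail: the central strata (holonomies at ±1, stabiliser SU(2)) might carry RLCT multiplicity 3 (a log² term) or a pole below 9L⁴−3/2 once the non-zero modes couple to the quartic cone, and t^θ-uniformity with poly(L) constants over all strata is unproved beyond the k=4 zero-mode toy.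
sources: doi:10.1017/cbo9780511800474, CosteEtAl1985, KollerVanbaal1986, Vanbaal2001, GonzalezarroyoAltes1988, doi:10.48550/arxiv.hep-th/9807108
[crux] TORON-VALLEY TUBE VOLUME LAW: there are p ≥ 0, K₁ > 0, q₁ ≥ 0, θ ∈ (0,1], sequences v(L) > 0,
e(L) ≥ 0, c(L) with |log v(L)| ≤ K₁L^(q₁), and L₀, such that for L ≥ L₀ and 0 < t ≤ (K₁L^(q₁))⁻¹ the
slowly varying factor e(L)·log t⁻¹ + c(L) is ≥ (K₁L^(q₁))⁻¹ and the ring-measure volume of {F₀ ≤ t}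
∩ {dist(·, {F₀ = 0}) ≤ L^(−p)} equals v·t^(9L⁴ − 3/2)·(e·log t⁻¹ + c)·(1 ± K₁L^(q₁)·t^θ) (dist = the
inlined squared chordal ring distance; F₀ = `RingDeficit.ringDeficit L 0`). [difficulty: L] -/
@[route_item "route-QuantumFields-ToronValleyVolume", crux]
def ToronTubeVolumeLaw : Prop :=
  ∃ p : ℝ, 0 ≤ p ∧ ∃ K₁ : ℝ, 0 < K₁ ∧ ∃ q₁ : ℝ, 0 ≤ q₁ ∧ ∃ θ : ℝ, 0 < θ ∧ θ ≤ 1 ∧ ∃ v e c : ℕ → ℝ, ∃ L₀ : ℕ, ∀ (L : ℕ) [NeZero L], L₀ ≤ L → 0 < v L ∧ 0 ≤ e L ∧ |Real.log (v L)| ≤ K₁ * (L : ℝ) ^ q₁ ∧ ∀ t : ℝ, 0 < t → t ≤ (K₁ * (L : ℝ) ^ q₁)⁻¹ → (K₁ * (L : ℝ) ^ q₁)⁻¹ ≤ e L * Real.log t⁻¹ + c L ∧ |(Summit.QuantumFields.YangMills.Theorems.VirialFluxGap.RingDeficit.ringMeasure L).real ({P | Summit.QuantumFields.YangMills.Theorems.VirialFluxGap.RingDeficit.ringDeficit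 L (fun _ => false) P ≤ t} ∩ {P | sInf ((fun Q : (Fin (2 * L - 1 + 1) → Literature.MathematicalPhysics.QuantumFieldTheory.GaugeConfig 3 L Summit.QuantumFields.YangMills.Theorems.FemtoTransferGap.SU2) × (Literature.MathematicalPhysics.QuantumFieldTheory.Site 3 L → Summit.QuantumFields.YangMills.Theorems.FemtoTransferGap.SU2) => (∑ i : Fin (2 * L - 1 + 1), (6 * (L : ℝ) ^ 3 - Summit.QuantumFields.YangMills.Theorems.FemtoTransferGap.timeCoupling Summit.QuantumFields.YangMills.Theorems.FemtoTransferGap.su2Rep (P.1 i) (Q.1 i))) + ∑ x : Literature.MathematicalPhysics.QuantumFieldTheory.Site 3 L, (2 - ((Summit.QuantumFields.YangMills.Theorems.FemtoTransferGap.su2Rep (P.2 x * (Q.2 x)⁻¹)).trace).re)) '' {Q | Summit.QuantumFields.YangMills.Theorems.VirialFluxGap.RingDeficit.ringDeficit L (fun _ => false) Q = 0}) ≤ ((L : ℝ) ^ p)⁻¹}) / (v L * t ^ (9 * (L : ℝ) ^ 4 - 3 / 2) * (e L * Real.log t⁻¹ + c L)) - 1| ≤ K₁ * (L : ℝ) ^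 q₁ * t ^ θ

/-- item stmt-QuantumFields-24498 · crux · rank 3 · closed · proved by Summit.QuantumFields.YangMills.Theorems.ToronValleyVolume.lojasiewiczLocalise_proof (prover) · by planner
why it might fail: needs gauge fixing over 2L·L³ sites with only poly(L) loss AND a quantitative almost-commuting ⇒ near-commuting bound for SU(2)⁴ with a FIXED Hölder exponent; near the cone point with non-zero modes coupled the prefactor could be e^(cL), not poly(L).
sources: doi:10.48550/arxiv.hep-th/9807108, GonzalezarroyoAltes1988, Vanbaal2001, KollerVanbaal1986, Luscher1983
[crux] POLYNOMIAL ŁOJASIEWICZ LOCALISATION for the periodic deficit: there are α ∈ (0,1], K > 0, q ≥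
0, L₀ such that for L ≥ L₀ and every ring history P with F₀(P) ≤ (K·L^q)⁻¹ one has dist(P, {F₀ = 0})
≤ K·L^q·F₀(P)^α (same inlined squared chordal distance; expected α = 1/2 from the quartic commutator
cone, α = 1 at regular points of the valley; the assembly needs only α > 0). It supplies the
localisation into the tube of ToronTubeVolumeLaw and excludes near-flat non-flat strata far from the
valley. [difficulty: L] -/
@[route_item "route-QuantumFields-ToronValleyVolume", crux]
def LojasiewiczLocalise : Prop :=
  ∃ α : ℝ, 0 < α ∧ α ≤ 1 ∧ ∃ K : ℝ, 0 < K ∧ ∃ q : ℝ, 0 ≤ q ∧ ∃ L₀ : ℕ, ∀ (L : ℕ) [NeZero L], L₀ ≤ L → ∀ P : (Fin (2 * L - 1 + 1) → Literature.MathematicalPhysics.QuantumFieldTheory.GaugeConfig 3 L Summit.QuantumFields.YangMills.Theorems.FemtoTransferGap.SU2) × (Literature.MathematicalPhysics.QuantumFieldTheory.Site 3 L → Summit.QuantumFields.YangMills.Theorems.FemtoTransferGap.SU2), Summit.QuantumFields.YangMills.Theorems.VirialFluxGap.RingDeficit.ringDeficit L (fun _ => false) P ≤ (K * (L : ℝ)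 ^ q)⁻¹ → sInf ((fun Q : (Fin (2 * L - 1 + 1) → Literature.MathematicalPhysics.QuantumFieldTheory.GaugeConfig 3 L Summit.QuantumFields.YangMills.Theorems.FemtoTransferGap.SU2) × (Literature.MathematicalPhysics.QuantumFieldTheory.Site 3 L → Summit.QuantumFields.YangMills.Theorems.FemtoTransferGap.SU2) => (∑ i : Fin (2 * L - 1 + 1), (6 * (L : ℝ) ^ 3 - Summit.QuantumFields.YangMills.Theorems.FemtoTransferGap.timeCoupling Summit.QuantumFields.YangMills.Theorems.FemtoTransferGap.su2Rep (P.1 i) (Q.1 i))) + ∑ x : Literature.MathematicalPhysics.QuantumFieldTheory.Site 3 L, (2 - ((Summit.QuantumFields.YangMills.Theorems.FemtoTransferGap.su2Rep (P.2 x * (Q.2 x)⁻¹)).trace).re)) '' {Q | Summit.QuantumFields.YangMills.Theorems.VirialFluxGap.RingDeficit.ringDeficit L (fun _ => false) Q = 0}) ≤ K * (L : ℝ) ^ q * (Summit.QuantumFields.YangMills.Theorems.VirialFluxGap.RingDeficit.ringDeficit L (fun _ => false) P) ^ α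

-- `LojasiewiczLocalise` holds: proved by `Summit.QuantumFields.YangMills.Theorems.ToronValleyVolume.lojasiewiczLocalise_proof` (its module imports this route file, so no `_holds` link can be stated here).

/-- item stmt-QuantumFields-24499 · support · rank 9 · closed · proved by Summit.QuantumFields.YangMills.Theorems.ToronValleyVolume.toronValleyVolume_tauberMeanUpper_proof (prover) · by planner
sources: book:ganeliusnd-tauberian-remainder-theorems, arXiv:2305.17604, doi:10.1017/cbo9780511800474
[support] UNIFORM TAUBERIAN MEAN BOUND with one slowly varying log factor (elementary,
dimension-explicit): on a probability space, a measurable F ≥ 0 with |μ(F ≤ t)/(v·t^ρ·(e·log t⁻¹ +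
c)) − 1| ≤ κ·t^θ and e·log t⁻¹ + c ≥ ℓ₀ > 0 on (0, t₀] (ρ ≥ 1, v > 0, e ≥ 0, κ ≥ 0, θ ∈ (0,1])
satisfies, for every β ≥ 2 with κ((ρ+2)/β)^θ ≤ 1/4 and 64(ρ+2)²(1 + |log v| + |log ℓ₀| + |log t₀| +
log β) ≤ β·t₀: β·∫F e^(−βF)dμ / ∫e^(−βF)dμ ≤ ρ + (4ρ+5)·κ·((ρ+2)/β)^θ + 2/β (verbatim the Prop of
the «tauber-mean» evidence skeleton on ⟨24141⟩; signed-kernel layer cake, IBP on (0,t₀], Chebyshev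
association for the decreasing slowly varying factor, Gautschi, exponential tails under the
threshold). [difficulty: M] -/
@[route_item "route-QuantumFields-ToronValleyVolume", crux]
def TauberMeanUpper : Prop :=
  ∀ (Ω : Type) [MeasurableSpace Ω] (μ : MeasureTheory.Measure Ω) [MeasureTheory.IsProbabilityMeasure μ] (F : Ω → ℝ) (ρ v e c κ θ t₀ ℓ₀ : ℝ), Measurable F → (∀ ω, 0 ≤ F ω) → 1 ≤ ρ → 0 < v → 0 ≤ e → 0 ≤ κ → 0 < θ → θ ≤ 1 → 0 < t₀ → 0 < ℓ₀ → (∀ t : ℝ, 0 < t → t ≤ t₀ → ℓ₀ ≤ e * Real.log t⁻¹ + c ∧ |μ.real {ω | F ω ≤ t} / (v * t ^ ρ * (e * Real.log t⁻¹ + c)) - 1| ≤ κ * t ^ θ) → ∀ β : ℝ, 2 ≤ β → κ * ((ρ + 2) / β) ^ θ ≤ 1 / 4 → 64 * (ρ + 2) ^ 2 * (1 + |Real.log v| + |Real.log ℓ₀| + |Real.log t₀| + Real.log β) ≤ β * t₀ → β * (∫ ω, F ω * Real.exp (-(β * F ω)) ∂μ) / (∫ ω, Real.exp (-(β * F ω))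 ∂μ) ≤ ρ + (4 * ρ + 5) * κ * ((ρ + 2) / β) ^ θ + 2 / β

-- `TauberMeanUpper` holds: proved by `Summit.QuantumFields.YangMills.Theorems.ToronValleyVolume.toronValleyVolume_tauberMeanUpper_proof` (its module imports this route file, so no `_holds` link can be stated here).

/-- item stmt-QuantumFields-24500 · assembly · rank 1 · closed · proved by Summit.QuantumFields.YangMills.Theorems.ToronValleyVolume.assembly_proof (prover) · by planner
sources: doi:10.1017/cbo9780511800474, arXiv:2305.17604
[assembly] ToronTubeVolumeLaw → LojasiewiczLocalise → TauberMeanUpper → PeriodicSoftness (localise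
by LojasiewiczLocalise, bound the mean by TauberMeanUpper on the window of the landed
WindowArithmeticZero, convert by the landed deficitFormZero; c := 1). [deps: ToronTubeVolumeLaw,
LojasiewiczLocalise, TauberMeanUpper] [difficulty: S] -/
@[route_item "route-QuantumFields-ToronValleyVolume"]
def Assembly : Prop :=
  ToronTubeVolumeLaw → LojasiewiczLocalise → TauberMeanUpper → Summit.QuantumFields.YangMills.Theses.VirialFluxGap.PeriodicSoftness

-- `Assembly` holds: proved by `Summit.QuantumFields.YangMills.Theorems.ToronValleyVolume.assembly_proof` (its module imports this route file, so no `_holds` link can be stated here).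

/-! D-0027 §2.1 — DECIDING THEOREM (planner-authored via `route open/edit --closes-file`; by planner-ym-idea-4-g15-0 2026-08-29T10:04:08Z):
its hypotheses are this route's items and its conclusion the sub-problem Statement (glue_lint), and it elaborates with this file. -/

@[closes "route-QuantumFields-ToronValleyVolume"] theorem closes (hV : ToronTubeVolumeLaw) (hG : LojasiewiczLocalise) (hT : TauberMeanUpper) :
    Summit.QuantumFields.YangMills.Theses.VirialFluxGap.PeriodicSoftness := by
  have hD := Summit.QuantumFields.YangMills.Theorems.VirialFluxGap.RingDeficit.deficitFormZero
  obtain ⟨p, hp, K₁, hK₁, q₁, hq₁, θ, hθ, hθ1, v, e, c, L₁, hV⟩ := hV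
  obtain ⟨α, hα, hα1, K, hK, q, hq, L₂, hG⟩ := hG
  -- the single worst constant `K' L^{q'}` with `K' = K₁ + K + K^{1/α}`, `q' = q₁ + q + (q + p)/α`
  have hKα : 0 < K ^ (1 / α) := Real.rpow_pos_of_pos hK _
  have hK'0 : 0 < K₁ + K + K ^ (1 / α) := by positivity
  have hαinv : 0 ≤ 1 / α := by positivity
  have hqpα : 0 ≤ (q + p) / α := by positivity
  have hq'0 : 0 ≤ q₁ + q + (q + p) / α := by positivity
  obtain ⟨a, ha, β₀, hW⟩ :=
    Summit.QuantumFields.YangMills.Theorems.VirialFluxGapPeriodicSoftnessWindow.stub_windowArithmeticZero (K₁ + K + K ^ (1 / α))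
      (q₁ + q + (q + p) / α) θ hK'0 hq'0 hθ hθ1
  refine ⟨a, ha, 1, one_pos, β₀, max (max L₁ L₂) 1, ?_⟩
  intro β hβ L _ hL hLwin
  have hL₁ : L₁ ≤ L := le_trans (le_trans (le_max_left _ _) (le_max_left _ _)) hL
  have hL₂ : L₂ ≤ L := le_trans (le_trans (le_max_right _ _) (le_max_left _ _)) hL
  have hL1 : 1 ≤ L := le_trans (le_max_right _ _) hL
  have hLr : (1 : ℝ) ≤ (L : ℝ) := by exact_mod_cast hL1
  have hL0 : (0 : ℝ) < (L : ℝ) := by linarith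
  obtain ⟨hvpos, hepos, hlogv, hvol⟩ := hV L hL₁
  have hGL := hG L hL₂
  obtain ⟨hmeas, hnonneg, hvir⟩ := hD L
  -- monomial bookkeeping
  set κ' : ℝ := (K₁ + K + K ^ (1 / α)) * (L : ℝ) ^ (q₁ + q + (q + p) / α) with hκ'def
  have hκ'pos : 0 < κ' := by positivity
  have hLq₁ : (L : ℝ) ^ q₁ ≤ (L : ℝ) ^ (q₁ + q + (q + p) / α) := Real.rpow_le_rpow_of_exponent_le hLr (by linarith)
  have hLq : (L : ℝ) ^ q ≤ (L : ℝ) ^ (q₁ + q + (q + p) / α) := Real.rpow_le_rpow_of_exponent_le hLr (by linarith)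
  have hL2 : (L : ℝ) ^ ((q + p) / α) ≤ (L : ℝ) ^ (q₁ + q + (q + p) / α) :=
    Real.rpow_le_rpow_of_exponent_le hLr (by linarith)
  have hκ₁ : K₁ * (L : ℝ) ^ q₁ ≤ κ' := mul_le_mul (by linarith [hKα.le]) hLq₁ (by positivity) hK'0.le
  have hκ₂ : K * (L : ℝ) ^ q ≤ κ' := mul_le_mul (by linarith [hKα.le]) hLq (by positivity) hK'0.le
  have hKLqp : 0 < K * (L : ℝ) ^ (q + p) := by positivity
  have hpow : (K * (L : ℝ) ^ (q + p)) ^ (1 / α) = K ^ (1 / α) * (L : ℝ) ^ ((q + p) / α) := by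
    rw [Real.mul_rpow hK.le (by positivity), ← Real.rpow_mul hL0.le]
    congr 2
    field_simp
  have hκ₃ : (K * (L : ℝ) ^ (q + p)) ^ (1 / α) ≤ κ' := by
    rw [hpow]; exact mul_le_mul (by linarith) hL2 (by positivity) hK'0.le
  have hκ₁pos : 0 < K₁ * (L : ℝ) ^ q₁ := by positivity
  have hκ₂pos : 0 < K * (L : ℝ) ^ q := by positivity
  have hκ₃pos : 0 < (K * (L : ℝ) ^ (q + p)) ^ (1 / α) := Real.rpow_pos_of_pos hKLqp _
  have hLp : 0 < (L : ℝ) ^ p := by positivity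
  have hlogv' : |Real.log (v L)| ≤ κ' := hlogv.trans hκ₁
  -- localisation: on `(0, κ'⁻¹]` the sublevel set lies inside the tube, so the tube law is the global law
  have hvol' : ∀ t : ℝ, 0 < t → t ≤ κ'⁻¹ →
      κ'⁻¹ ≤ e L * Real.log t⁻¹ + c L ∧
      |(Summit.QuantumFields.YangMills.Theorems.VirialFluxGap.RingDeficit.ringMeasure L).real
          {P | Summit.QuantumFields.YangMills.Theorems.VirialFluxGap.RingDeficit.ringDeficit L (fun _ => false) P ≤ t} /
          (v L * t ^ (9 * (L : ℝ) ^ 4 - 3 / 2) * (e L * Real.log t⁻¹ + c L)) - 1| ≤ κ' * t ^ θ := by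
    intro t ht htle
    have ht₁ : t ≤ (K₁ * (L : ℝ) ^ q₁)⁻¹ := htle.trans (inv_anti₀ hκ₁pos hκ₁)
    have ht₂ : t ≤ (K * (L : ℝ) ^ q)⁻¹ := htle.trans (inv_anti₀ hκ₂pos hκ₂)
    have ht₃ : t ≤ ((K * (L : ℝ) ^ (q + p)) ^ (1 / α))⁻¹ := htle.trans (inv_anti₀ hκ₃pos hκ₃)
    obtain ⟨hlow, h⟩ := hvol t ht ht₁
    refine ⟨(inv_anti₀ hκ₁pos hκ₁).trans hlow, ?_⟩
    rw [Set.inter_eq_left.mpr] at h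
    · exact h.trans (mul_le_mul_of_nonneg_right hκ₁ (Real.rpow_nonneg ht.le θ))
    · intro P hP
      simp only [Set.mem_setOf_eq] at hP ⊢
      have h1 := hGL P (hP.trans ht₂)
      refine h1.trans ?_
      have hFα : (Summit.QuantumFields.YangMills.Theorems.VirialFluxGap.RingDeficit.ringDeficit L (fun _ => false) P) ^ α ≤
          (K * (L : ℝ) ^ (q + p))⁻¹ := by
        calc _ ≤ t ^ α := Real.rpow_le_rpow (hnonneg P) hP hα.le
          _ ≤ (((K * (L : ℝ) ^ (q + p)) ^ (1 / α))⁻¹) ^ α := Real.rpow_le_rpow ht.le ht₃ hα.le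
          _ = (K * (L : ℝ) ^ (q + p))⁻¹ := by
              rw [Real.inv_rpow hκ₃pos.le, ← Real.rpow_mul hKLqp.le]
              have : 1 / α * α = 1 := by field_simp
              rw [this, Real.rpow_one]
      calc K * (L : ℝ) ^ q * _ ≤ K * (L : ℝ) ^ q * (K * (L : ℝ) ^ (q + p))⁻¹ :=
            mul_le_mul_of_nonneg_left hFα hκ₂pos.le
        _ = ((L : ℝ) ^ p)⁻¹ := by
            rw [Real.rpow_add hL0]
            field_simp
  -- the window arithmetic and the Tauberian mean bound
  obtain ⟨hβ2, hy, hthr, herr⟩ := hW β hβ L hL1 hLwin (Real.log (v L)) hlogv'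
  have hβpos : 0 < β := by linarith
  have hρ : (1 : ℝ) ≤ 9 * (L : ℝ) ^ 4 - 3 / 2 := by
    have h4 : (1 : ℝ) ≤ (L : ℝ) ^ 4 := one_le_pow₀ hLr
    linarith
  haveI : MeasureTheory.IsProbabilityMeasure (Summit.QuantumFields.YangMills.Theorems.FemtoTransferGap.TT.gaugeMeasure L) :=
    Summit.QuantumFields.YangMills.Theorems.FemtoTransferGap.TT.isProbabilityMeasure_gaugeMeasure (L := L)
  haveI : MeasureTheory.IsProbabilityMeasure (Summit.QuantumFields.YangMills.Theorems.VirialFluxGap.RingDeficit.ringMeasure L) := by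
    unfold Summit.QuantumFields.YangMills.Theorems.VirialFluxGap.RingDeficit.ringMeasure; infer_instance
  have hT' := hT _ (Summit.QuantumFields.YangMills.Theorems.VirialFluxGap.RingDeficit.ringMeasure L)
    (Summit.QuantumFields.YangMills.Theorems.VirialFluxGap.RingDeficit.ringDeficit L (fun _ => false)) (9 * (L : ℝ) ^ 4 - 3 / 2)
    (v L) (e L) (c L) κ' θ κ'⁻¹ κ'⁻¹
    hmeas hnonneg hρ hvpos hepos hκ'pos.le hθ hθ1 (inv_pos.mpr hκ'pos) (inv_pos.mpr hκ'pos) hvol' β hβ2 hy hthr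
  rw [hvir β hβpos]
  linarith

end Summit.QuantumFields.YangMills.Theses.ToronValleyVolume
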